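import Literature.AlgebraicGeometry.HodgeTheory.FermatShiodaCondition
import HarnessLib

/-!
# Aoki's `2`-standard element `σ_{2,x}` is a Hodge multiset at every even level — line `cancel-by-any-claim-lattice`, crux `HodgeFermatVarieties` (stmt-HodgeConjecture-1334)

For `m = 2M` and `x ∈ ℤ/2M` with `x ∉ {0, M}`, Aoki's `2`-standard element
`σ_{2,x} = (x, x + M, -2x, M)` (Aoki, J. Math. Soc. Japan 39 (1987) §1 p. 387: "`σ_{2,i} ∈ 𝔅²ₘ`", a
Hodge character of the Fermat SURFACE of degree `2M`) is a Hodge multiset in the sense of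
`FermatCharacter.IsHodgeMultiset` (Shioda's semigroup `Mₘ`): zero-free, of sum `0`, and
`2 Σ⟨t y⟩ = 2M · 4` for every unit `t` of `ℤ/2M` (`stub_isHodgeMultiset_sigmaTwo`, stub S9 of the line).
The tree's `FermatCharacter.isHodgeMultiset_std` (with `p = 2`) is the case `M = 2ᵏ⁻¹` only; here the
level is an arbitrary even number (the line's doubling lemma uses it at `M` odd).

Proof: a unit `t` of `ℤ/2M` is an odd residue, so `t M = M` (`unit_mul_natCast_half`) and
`t • σ_{2,x} = σ_{2,tx}` with again `tx ∉ {0, M}`; and for `y ∉ {0, M}` with `r = ⟨y⟩` the four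
representatives are `r, r + M, 2M - 2r, M` if `r < M` and `r, r - M, 4M - 2r, M` if `r > M`, of sum
`4M` either way (`two_mul_mNormSum_sigmaTwo`). Arithmetic only (`ZMod.val_add_of_lt/le`,
`ZMod.neg_val`, `omega`).

## References

* [Aoki1987] N. Aoki, Some new algebraic cycles on Fermat varieties, J. Math. Soc. Japan 39 (1987)
  385–396, §1 p. 387.
* [Shioda1979PJA] T. Shioda, Proc. Japan Acad. 55A (1979) 111–114, §1 (the semigroup `Mₘ`,
  eqs. (2), (3)).
-/

set_option linter.dupNamespace false

noncomputable section

open Finset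
open Literature.AlgebraicGeometry.HodgeTheory Literature.AlgebraicGeometry.HodgeTheory.FermatCharacter

namespace Summit.HodgeConjecture.HodgeConjecture.Theorems.CancelByAnyClaimLattice.SigmaTwo

variable {M : ℕ}

/-- `M + M = 2M = 0` in `ℤ/2M`. [folklore] -/
theorem natCast_half_add_natCast_half : (M : ZMod (2 * M)) + M = 0 := by
  rw [← Nat.cast_add, ← two_mul, ZMod.natCast_self]

/-- `M` is self-negative in `ℤ/2M`: `-M = M`. [folklore] -/
theorem neg_natCast_half : -(M : ZMod (2 * M)) = M :=
  neg_eq_of_add_eq_zero_right natCast_half_add_natCast_half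

/-- The representative of `M` in `ℤ/2M` is `M` (`0 ≤ M < 2M` for `M ≠ 0`). [folklore] -/
theorem val_natCast_half [NeZero M] : (M : ZMod (2 * M)).val = M := by
  rw [ZMod.val_natCast]
  exact Nat.mod_eq_of_lt (by have := NeZero.ne M; omega)

/-- `M ≠ 0` in `ℤ/2M` (`0 < M < 2M`). [folklore] -/
theorem natCast_half_ne_zero [NeZero M] : (M : ZMod (2 * M)) ≠ 0 := by
  intro h
  have h1 := congrArg ZMod.val h
  rw [val_natCast_half, ZMod.val_zero] at h1
  exact NeZero.ne M h1

/-- In `ℤ/2M` the `2`-torsion is `{0, M}`: `2y ≠ 0` for `y ∉ {0, M}` (`2M ∣ 2⟨y⟩` forces `M ∣ ⟨y⟩ < 2M`).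
[folklore] -/
theorem two_mul_ne_zero [NeZero M] {y : ZMod (2 * M)} (hy0 : y ≠ 0) (hyM : y ≠ (M : ZMod (2 * M))) :
    (2 : ZMod (2 * M)) * y ≠ 0 := by
  haveI : NeZero (2 * M) := ⟨by have := NeZero.ne M; omega⟩
  intro h
  have hcast : (2 : ZMod (2 * M)) * y = ((2 * y.val : ℕ) : ZMod (2 * M)) := by
    rw [Nat.cast_mul, Nat.cast_ofNat, ZMod.natCast_zmod_val]
  rw [hcast, ZMod.natCast_eq_zero_iff] at h
  have hdvd : M ∣ y.val := Nat.dvd_of_mul_dvd_mul_left two_pos h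
  obtain ⟨c, hc⟩ := hdvd
  have hlt : y.val < 2 * M := ZMod.val_lt y
  have hM : 0 < M := Nat.pos_of_ne_zero (NeZero.ne M)
  have hc2 : c < 2 := by
    by_contra hc2
    have : M * 2 ≤ M * c := Nat.mul_le_mul_left M (by omega)
    omega
  interval_cases c
  · exact hy0 ((ZMod.val_eq_zero y).mp (by omega))
  · exact hyM (by rw [← ZMod.natCast_zmod_val y, hc, mul_one])

/-- Units of `ℤ/2M` are odd residues, hence fix `M`: `t M = M`. [folklore] -/
theorem unit_mul_natCast_half [NeZero M] (t : (ZMod (2 * M))ˣ) : (t : ZMod (2 * M)) * M = M := by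
  haveI : NeZero (2 * M) := ⟨by have := NeZero.ne M; omega⟩
  have hcop := ZMod.val_coe_unit_coprime t
  have hodd : ¬ 2 ∣ (t : ZMod (2 * M)).val := by
    intro h2
    have h := Nat.dvd_gcd h2 (dvd_mul_right 2 M)
    rw [hcop.gcd_eq_one] at h
    exact absurd h (by norm_num)
  obtain ⟨s, hs⟩ : Odd (t : ZMod (2 * M)).val := Nat.odd_iff.mpr (Nat.two_dvd_ne_zero.mp hodd)
  have h2M : 2 * (M : ZMod (2 * M)) = 0 :=
    (two_mul (M : ZMod (2 * M))).trans natCast_half_add_natCast_half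
  calc (t : ZMod (2 * M)) * M = (((t : ZMod (2 * M)).val : ℕ) : ZMod (2 * M)) * M := by
        rw [ZMod.natCast_zmod_val]
    _ = M := by
        rw [hs]
        push_cast
        linear_combination (s : ZMod (2 * M)) * h2M

/-- **The norm of `σ_{2,y}`**: for `y ∉ {0, M}`, `2 (⟨y⟩ + ⟨y + M⟩ + ⟨-2y⟩ + ⟨M⟩) = 2M · 4` — with
`r = ⟨y⟩`, the representatives are `r, r + M, 2M - 2r, M` (`r < M`) or `r, r - M, 4M - 2r, M` (`r > M`).
[cite: Aoki1987, §1 p. 387 (σ_{2,i} ∈ 𝔅²ₘ)] -/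
theorem two_mul_mNormSum_sigmaTwo [NeZero M] {y : ZMod (2 * M)} (hy0 : y ≠ 0)
    (hyM : y ≠ (M : ZMod (2 * M))) :
    2 * mNormSum ({y, y + (M : ZMod (2 * M)), -(2 * y), (M : ZMod (2 * M))} : Multiset (ZMod (2 * M))) =
      2 * M * 4 := by
  haveI : NeZero (2 * M) := ⟨by have := NeZero.ne M; omega⟩
  have hM : 0 < M := Nat.pos_of_ne_zero (NeZero.ne M)
  have h2y : (2 : ZMod (2 * M)) * y ≠ 0 := two_mul_ne_zero hy0 hyM
  have hr : y.val < 2 * M := ZMod.val_lt y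
  have hrM : y.val ≠ M := fun h ↦ hyM (by rw [← ZMod.natCast_zmod_val y, h])
  have hneg : (-(2 * y)).val = 2 * M - (y + y).val := by
    rw [ZMod.neg_val, if_neg h2y, two_mul y]
  have hunf : mNormSum ({y, y + (M : ZMod (2 * M)), -(2 * y), (M : ZMod (2 * M))} : Multiset (ZMod (2 * M))) =
      y.val + ((y + (M : ZMod (2 * M))).val + ((-(2 * y)).val + (M : ZMod (2 * M)).val)) := by
    simp only [mNormSum, Multiset.insert_eq_cons, Multiset.map_cons, Multiset.map_singleton,
      Multiset.sum_cons, Multiset.sum_singleton]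
  rw [hunf, hneg, val_natCast_half]
  rcases Nat.lt_or_ge y.val M with hlt | hle
  · have h1 : (y + (M : ZMod (2 * M))).val = y.val + M := by
      rw [ZMod.val_add_of_lt (by rw [val_natCast_half]; omega), val_natCast_half]
    have h2 : (y + y).val = y.val + y.val := ZMod.val_add_of_lt (by omega)
    rw [h1, h2]
    omega
  · have h1 : (y + (M : ZMod (2 * M))).val = y.val + M - 2 * M := by
      rw [ZMod.val_add_of_le (by rw [val_natCast_half]; omega), val_natCast_half]
    have h2 : (y + y).val = y.val + y.val - 2 * M := ZMod.val_add_of_le (by omega)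
    rw [h1, h2]
    omega

/-- **S9 `stub_isHodgeMultiset_sigmaTwo` — Aoki's `2`-standard element is a Hodge multiset at EVERY even
level.** For `m = 2M` and `x ∈ ℤ/2M` with `x ∉ {0, M}`, the multiset `σ_{2,x} = (x, x + M, -2x, M)` is
zero-free (`x + M = 0 ⟺ x = -M = M`; `2x = 0 ⟺ x ∈ {0, M}`; `0 < M < 2M`), has sum `2M = 0`, and
`2 Σ⟨t y⟩ = 4 · 2M` for every unit `t` (`t M = M`, so `t • σ_{2,x} = σ_{2,tx}` with `tx ∉ {0, M}`, and
`two_mul_mNormSum_sigmaTwo`). The tree's `FermatCharacter.isHodgeMultiset_std` (`p = 2`) is the case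
`M = 2ᵏ⁻¹`. [cite: Aoki1987, §1 p. 387 (σ_{2,i} ∈ 𝔅²ₘ)] -/
theorem stub_isHodgeMultiset_sigmaTwo :
    ∀ (M : ℕ) [NeZero M] (x : ZMod (2 * M)), x ≠ 0 → x ≠ (M : ZMod (2 * M)) →
      IsHodgeMultiset ({x, x + (M : ZMod (2 * M)), -(2 * x), (M : ZMod (2 * M))} : Multiset (ZMod (2 * M))) := by
  intro M _ x hx0 hxM
  haveI : NeZero (2 * M) := ⟨by have := NeZero.ne M; omega⟩
  refine ⟨⟨?_, ?_⟩, fun t ↦ ?_⟩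
  · -- zero-free
    intro a ha
    simp only [Multiset.insert_eq_cons, Multiset.mem_cons, Multiset.mem_singleton] at ha
    rcases ha with rfl | rfl | rfl | rfl
    · exact hx0
    · intro h
      apply hxM
      rw [eq_neg_of_add_eq_zero_left h, neg_natCast_half]
    · exact neg_ne_zero.mpr (two_mul_ne_zero hx0 hxM)
    · exact natCast_half_ne_zero
  · -- sum zero
    simp only [Multiset.insert_eq_cons, Multiset.sum_cons, Multiset.sum_singleton]
    linear_combination (natCast_half_add_natCast_half (M := M))
  · -- Shioda's norm equations
    have htM : (t : ZMod (2 * M)) * M = M := unit_mul_natCast_half t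
    have hmap : (({x, x + (M : ZMod (2 * M)), -(2 * x), (M : ZMod (2 * M))} : Multiset (ZMod (2 * M))).map
        fun a ↦ (t : ZMod (2 * M)) * a) =
        {(t : ZMod (2 * M)) * x, (t : ZMod (2 * M)) * x + (M : ZMod (2 * M)),
          -(2 * ((t : ZMod (2 * M)) * x)), (M : ZMod (2 * M))} := by
      simp only [Multiset.insert_eq_cons, Multiset.map_cons, Multiset.map_singleton]
      rw [mul_add, htM, mul_neg, mul_left_comm (t : ZMod (2 * M)) 2 x]
    have hcard : Multiset.card (({x, x + (M : ZMod (2 * M)), -(2 * x), (M : ZMod (2 * M))} :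
        Multiset (ZMod (2 * M)))) = 4 := by
      simp
    rw [hcard, hmap]
    refine two_mul_mNormSum_sigmaTwo ((Units.mul_right_eq_zero t).not.mpr hx0) fun h ↦ hxM ?_
    rw [← htM] at h
    exact (Units.mul_right_inj t).mp h

end Summit.HodgeConjecture.HodgeConjecture.Theorems.CancelByAnyClaimLattice.SigmaTwo
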